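import Literature.Geometry.Symplectic.JHolomorphicChartLocalisation
import Literature.Geometry.Symplectic.AlmostComplexStructure
import Literature.Geometry.Symplectic.JHolomorphicMap
import HarnessLib

/-!
# An almost complex structure read through an immersion of an open subset of the model space

Let `X` be a `C^∞` manifold modelled on `ℝⁿ = EuclideanSpace ℝ (Fin n)`, `J` a field of
endomorphisms of its tangent spaces with `J x ∘ J x = -1` which is smooth in the sense used by
the summit statements (its frame expression `inTangentCoordinates (𝓡 n) (𝓡 n) id id J x₀` is `C^∞`
at every `x₀`; for a bundled `JX : AlmostComplexStructure (𝓡 n) ∞ X` this is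
`AlmostComplexStructure.inTangentCoordinates_contMDiffAt`), and let `κ : V → X` be `C^∞` on an
open subset `W` of a real normed space `V` of dimension `n` with injective differential
`dκ(q) = mfderiv 𝓘(ℝ, V) (𝓡 n) κ q` at every `q ∈ W` (an immersion between manifolds of the same
dimension, i.e. a local diffeomorphism onto an open subset of `X`: a parametrisation). Then

* `exists_coordJ_of_immersion`: there is a field `Jc : V → End(V)`, `C^∞` on `W`, with
  `Jc q (Jc q v) = -v` and `dκ(q) (Jc q v) = J (κ q) (dκ(q) v)` for `q ∈ W` — the **coordinate
  expression `κ^* J` of `J` through `κ`**; it is unique (`coordJ_unique`: the intertwining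
  determines `Jc q`, because `dκ(q)` is injective), namely `Jc q = dκ(q)⁻¹ ∘ J (κ q) ∘ dκ(q)`;
  `exists_coordJ_of_immersion'` is the same statement for a bundled
  `JX : AlmostComplexStructure (𝓡 n) ∞ X`;
* `isJHolomorphicAt_iff_coord` (pointwise), `isJHolomorphic_comp_iff_coord`,
  `isJHolomorphic_comp_iff_isJHolomorphicFlat`: **transfer of `J`-holomorphicity** — for
  `v : ℂ → W` real-differentiable, `κ ∘ v` is `J`-holomorphic (`d(κ ∘ v)(iζ) = J d(κ ∘ v)(ζ)`,
  `Literature.Geometry.Symplectic.IsJHolomorphic`) iff `v` is `Jc`-holomorphic in the flat sense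
  `dv(z)(iζ) = Jc (v z) (dv(z) ζ)` (`Literature.Geometry.Symplectic.IsJHolomorphicFlat`). These
  only use the intertwining identity and hold for any target manifold.

This is the bookkeeping by which the nonlinear Cauchy–Riemann equation for curves near an embedded
`J`-holomorphic curve is written, in a parametrised neighbourhood, as the flat equation
`∂ₛu + Jc(u) ∂ₜu = 0` for maps into a vector space (Wendl 2018, §2.2 and the proof of Thm. 2.46;
McDuff–Salamon 2012, §2.2, §3.1).

## Proof of the existence statement

Pointwise, `Jc q := dκ(q)⁻¹ ∘ J (κ q) ∘ dκ(q)` with Mathlib's total `ContinuousLinearMap.inverse`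
(`dκ(q) : V → ℝⁿ` is injective between spaces of dimension `n`, hence invertible,
`ChartLocalisation.isInvertible_of_injective_of_finrank_eq`); the square and the intertwining are
one-line computations. Smoothness is local and uses no partition of unity: near `q₀ ∈ W` let `φ₀`
be the extended chart at `κ q₀`, `G = φ₀ ∘ κ` (a `C^∞` map on the open set
`W₀ = W ∩ κ⁻¹(chart domain)`, `ChartLocalisation.contDiffAt_extChartAt_comp_of_contMDiffAt`) with
differential `D(q) = A ∘ dκ(q)`, `A = dφ₀(κ q)`
(`ChartLocalisation.fderiv_extChartAt_comp_apply_of_contMDiffAt`). By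
`ChartLocalisation.exists_chartJ` the frame expression of `J` is a `C^∞` field `Jch` on the chart
target with `Jch (φ₀ x) = A ∘ J x ∘ A⁻¹`; hence `q ↦ D(q)⁻¹ ∘ Jch (G q) ∘ D(q)` is `C^∞` on `W₀`
(`ContinuousLinearMap.IsInvertible.contDiffAt_map_inverse`, `ContDiffOn.clm_comp`) and is
intertwined with `J (κ q)` by `dκ(q)`, so it equals `Jc q` on `W₀` by uniqueness.

Deliberately NOT here: immersions of positive codimension (then `κ^* J` need not exist), the
dependence of `Jc` on `J`, and any analysis of the flat equation.

## References

* C. Wendl, *Holomorphic Curves in Low Dimensions*, Lecture Notes in Math. 2216 (2018), §2.2,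
  Thm. 2.46. [Wendl2018]
* D. McDuff, D. Salamon, *J-holomorphic Curves and Symplectic Topology*, 2nd ed. (2012), §2.2,
  §3.1. [McDuffSalamon2012]
* C. Hummel, *Gromov's Compactness Theorem for Pseudo-holomorphic Curves* (1997), Ch. I §3,
  eq. (3.1) (`J`-holomorphic maps). [Hummel1997]
-/

noncomputable section

open scoped Manifold ContDiff Topology
open Set Filter Function

namespace Literature.Geometry.Symplectic

/-! ### Uniqueness of the coordinate expression; transfer of `J`-holomorphicity -/

section Transfer

variable {E : Type*} [NormedAddCommGroup E] [NormedSpace ℝ E] {H : Type*} [TopologicalSpace H]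
  {I : ModelWithCorners ℝ E H} {M : Type*} [TopologicalSpace M] [ChartedSpace H M]
  {V : Type*} [NormedAddCommGroup V] [NormedSpace ℝ V]

/-- **Uniqueness of the coordinate expression of `J` through `κ`.** If the differential
`dκ(q) = mfderiv 𝓘(ℝ, V) I κ q` is injective, an endomorphism `T` of `V` with
`dκ(q) (T v) = J (κ q) (dκ(q) v)` for all `v` is unique. [folklore] -/
theorem coordJ_unique (J : ∀ x : M, TangentSpace I x →L[ℝ] TangentSpace I x) {κ : V → M} {q : V}
    (hκimm : Injective (mfderiv 𝓘(ℝ, V) I κ q)) {T T' : V →L[ℝ] V}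
    (hT : ∀ v : V, mfderiv 𝓘(ℝ, V) I κ q (T v) = J (κ q) (mfderiv 𝓘(ℝ, V) I κ q v))
    (hT' : ∀ v : V, mfderiv 𝓘(ℝ, V) I κ q (T' v) = J (κ q) (mfderiv 𝓘(ℝ, V) I κ q v)) :
    T = T' :=
  ContinuousLinearMap.ext fun v => hκimm ((hT v).trans (hT' v).symm)

/-- **Transfer of `J`-holomorphicity at a point** (pointwise hypotheses). Let `κ : V → M` be
differentiable at `v z` with injective differential `dκ(v z)`, `v : ℂ → V` real-differentiable at
`z`, and `Jc (v z)` an endomorphism of `V` intertwined with `J (κ (v z))` by `dκ(v z)`. Then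
`d(κ ∘ v)(z)(iζ) = J (d(κ ∘ v)(z) ζ)` for all `ζ` iff `dv(z)(iζ) = Jc (v z) (dv(z) ζ)` for all `ζ`
(chain rule `d(κ ∘ v)(z) = dκ(v z) ∘ dv(z)`, then cancel the injective `dκ(v z)`; Hummel 1997,
(3.1), read in a parametrisation). [folklore] -/
theorem isJHolomorphicAt_iff_coord_of_mdifferentiableAt
    (J : ∀ x : M, TangentSpace I x →L[ℝ] TangentSpace I x) {κ : V → M} {Jc : V → V →L[ℝ] V}
    {v : ℂ → V} {z : ℂ} (hκ : MDifferentiableAt 𝓘(ℝ, V) I κ (v z))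
    (hκimm : Injective (mfderiv 𝓘(ℝ, V) I κ (v z))) (hv : DifferentiableAt ℝ v z)
    (hint : ∀ w : V, mfderiv 𝓘(ℝ, V) I κ (v z) (Jc (v z) w) =
      J (κ (v z)) (mfderiv 𝓘(ℝ, V) I κ (v z) w)) :
    (∀ ζ : ℂ, mfderiv 𝓘(ℝ, ℂ) I (κ ∘ v) z (Complex.I * ζ) =
        J (κ (v z)) (mfderiv 𝓘(ℝ, ℂ) I (κ ∘ v) z ζ)) ↔
      ∀ ζ : ℂ, fderiv ℝ v z (Complex.I * ζ) = Jc (v z) (fderiv ℝ v z ζ) := by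
  have hvd : MDifferentiableAt 𝓘(ℝ, ℂ) 𝓘(ℝ, V) v z := hv.mdifferentiableAt
  have hchain : ∀ ζ : ℂ, mfderiv 𝓘(ℝ, ℂ) I (κ ∘ v) z ζ =
      mfderiv 𝓘(ℝ, V) I κ (v z) (fderiv ℝ v z ζ) := fun ζ => by
    rw [mfderiv_comp_apply _ hκ hvd, mfderiv_eq_fderiv]
    rfl
  constructor
  · intro h ζ
    apply hκimm
    rw [hint, ← hchain, ← hchain]
    exact h ζ
  · intro h ζ
    rw [hchain, hchain, h ζ, hint]

/-- **Transfer of `J`-holomorphicity at a point.** Let `κ` be `C^∞` on the open set `W ⊆ V` with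
injective differential there, `v : ℂ → V` real-differentiable at `z` with `v z ∈ W`, and `Jc (v z)`
intertwined with `J (κ (v z))` by `dκ(v z)` (e.g. the field of `exists_coordJ_of_immersion`). Then
`d(κ ∘ v)(z)(iζ) = J (d(κ ∘ v)(z) ζ)` for all `ζ` iff `dv(z)(iζ) = Jc (v z) (dv(z) ζ)` for all
`ζ`. [folklore] -/
theorem isJHolomorphicAt_iff_coord (J : ∀ x : M, TangentSpace I x →L[ℝ] TangentSpace I x)
    {κ : V → M} {W : Set V} (hW : IsOpen W) (hκ : ContMDiffOn 𝓘(ℝ, V) I ∞ κ W)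
    (hκimm : ∀ q ∈ W, Injective (mfderiv 𝓘(ℝ, V) I κ q))
    {Jc : V → V →L[ℝ] V} {v : ℂ → V} {z : ℂ} (hv : DifferentiableAt ℝ v z) (hvz : v z ∈ W)
    (hint : ∀ w : V, mfderiv 𝓘(ℝ, V) I κ (v z) (Jc (v z) w) =
      J (κ (v z)) (mfderiv 𝓘(ℝ, V) I κ (v z) w)) :
    (∀ ζ : ℂ, mfderiv 𝓘(ℝ, ℂ) I (κ ∘ v) z (Complex.I * ζ) =
        J (κ (v z)) (mfderiv 𝓘(ℝ, ℂ) I (κ ∘ v) z ζ)) ↔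
      ∀ ζ : ℂ, fderiv ℝ v z (Complex.I * ζ) = Jc (v z) (fderiv ℝ v z ζ) :=
  isJHolomorphicAt_iff_coord_of_mdifferentiableAt J
    ((hκ.contMDiffAt (hW.mem_nhds hvz)).mdifferentiableAt (by simp)) (hκimm (v z) hvz) hv hint

/-- **Transfer of `J`-holomorphicity.** Let `κ` be `C^∞` on the open set `W ⊆ V` with injective
differential there, `Jc` intertwined with `J` by `dκ` on `W`, and `v : ℂ → V` real-differentiable
with values in `W`. Then `κ ∘ v` is `J`-holomorphic (`IsJHolomorphic`: `d(κ ∘ v)(z)(iζ) =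
J (d(κ ∘ v)(z) ζ)` for all `z`, `ζ`) iff `dv(z)(iζ) = Jc (v z) (dv(z) ζ)` for all `z`, `ζ`.
[folklore] -/
theorem isJHolomorphic_comp_iff_coord (J : ∀ x : M, TangentSpace I x →L[ℝ] TangentSpace I x)
    {κ : V → M} {W : Set V} (hW : IsOpen W) (hκ : ContMDiffOn 𝓘(ℝ, V) I ∞ κ W)
    (hκimm : ∀ q ∈ W, Injective (mfderiv 𝓘(ℝ, V) I κ q)) {Jc : V → V →L[ℝ] V}
    (hint : ∀ q ∈ W, ∀ w : V, mfderiv 𝓘(ℝ, V) I κ q (Jc q w) =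
      J (κ q) (mfderiv 𝓘(ℝ, V) I κ q w))
    {v : ℂ → V} (hv : Differentiable ℝ v) (hvW : ∀ z, v z ∈ W) :
    IsJHolomorphic I (fun y => J y) (κ ∘ v) ↔
      ∀ z ζ : ℂ, fderiv ℝ v z (Complex.I * ζ) = Jc (v z) (fderiv ℝ v z ζ) :=
  forall_congr' fun z =>
    isJHolomorphicAt_iff_coord J hW hκ hκimm (hv z) (hvW z) (hint _ (hvW z))

/-- **Transfer of `J`-holomorphicity, flat form.** Under the hypotheses of
`isJHolomorphic_comp_iff_coord`, `κ ∘ v` is `J`-holomorphic iff `v` is flat `Jc`-holomorphic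
(`IsJHolomorphicFlat Jc v`). [folklore] -/
theorem isJHolomorphic_comp_iff_isJHolomorphicFlat
    (J : ∀ x : M, TangentSpace I x →L[ℝ] TangentSpace I x)
    {κ : V → M} {W : Set V} (hW : IsOpen W) (hκ : ContMDiffOn 𝓘(ℝ, V) I ∞ κ W)
    (hκimm : ∀ q ∈ W, Injective (mfderiv 𝓘(ℝ, V) I κ q)) {Jc : V → V →L[ℝ] V}
    (hint : ∀ q ∈ W, ∀ w : V, mfderiv 𝓘(ℝ, V) I κ q (Jc q w) =
      J (κ q) (mfderiv 𝓘(ℝ, V) I κ q w))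
    {v : ℂ → V} (hv : Differentiable ℝ v) (hvW : ∀ z, v z ∈ W) :
    IsJHolomorphic I (fun y => J y) (κ ∘ v) ↔ IsJHolomorphicFlat Jc v :=
  isJHolomorphic_comp_iff_coord J hW hκ hκimm hint hv hvW

/-- **A `C^m` almost complex structure is `C^m` in tangent coordinates**: for a bundled
`JX : AlmostComplexStructure I m M`, the frame expression
`inTangentCoordinates I I id id (fun x ↦ JX x) x₀` of the section `JX` of `End(TM)` is `C^m` at
`x₀` (the second component of Mathlib's `contMDiffAt_hom_bundle`). This is the regularity
hypothesis `hJ` of `exists_coordJ_of_immersion` and of the chart-localisation files; general-model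
version of the dimension-`4` bridge in `JSphereMeetsEmbeddedJSphere.lean`. [folklore] -/
theorem AlmostComplexStructure.inTangentCoordinates_contMDiffAt [IsManifold I 1 M]
    {m : WithTop ℕ∞} (JX : AlmostComplexStructure I m M) (x₀ : M) :
    ContMDiffAt I 𝓘(ℝ, E →L[ℝ] E) m
      (inTangentCoordinates I I (id : M → M) id
        (fun x => (JX x : TangentSpace I x →L[ℝ] TangentSpace I x)) x₀) x₀ :=
  ((contMDiffAt_hom_bundle _).1 (JX.contMDiff' x₀)).2

end Transfer

/-! ### Chart calculus for maps from a normed space -/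

namespace ChartLocalisation

section ChartCalculus

variable {n : ℕ} {X : Type*} [TopologicalSpace X] [ChartedSpace (EuclideanSpace ℝ (Fin n)) X]
  [IsManifold (𝓡 n) ∞ X] {V : Type*} [NormedAddCommGroup V] [NormedSpace ℝ V]

/-- Chain rule in a chart for a map `κ : V → X` from a normed space, `C^∞` at `q` with `κ q` in
the source of the chart at `x₀`: the derivative of the chart expression `φ₀ ∘ κ` at `q` is
`mfderiv φ₀ (κ q) ∘ mfderiv κ q` (`HasMFDerivAt.comp`, `mfderiv_eq_fderiv`; the case `V = ℂ` is
`ChartLocalisation.fderiv_extChartAt_comp_apply`). [folklore] -/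
theorem fderiv_extChartAt_comp_apply_of_contMDiffAt {x₀ : X} {κ : V → X} {q : V}
    (hκ : ContMDiffAt 𝓘(ℝ, V) (𝓡 n) ∞ κ q)
    (hq : κ q ∈ (chartAt (EuclideanSpace ℝ (Fin n)) x₀).source) (v : V) :
    fderiv ℝ (fun p : V => extChartAt (𝓡 n) x₀ (κ p)) q v =
      mfderiv (𝓡 n) 𝓘(ℝ, EuclideanSpace ℝ (Fin n)) (extChartAt (𝓡 n) x₀) (κ q)
        (mfderiv 𝓘(ℝ, V) (𝓡 n) κ q v) := by
  have h := ((mdifferentiableAt_extChartAt (I := 𝓡 n) hq).hasMFDerivAt.comp q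
    ((hκ.mdifferentiableAt (by simp)).hasMFDerivAt)).mfderiv
  rw [mfderiv_eq_fderiv] at h
  exact DFunLike.congr_fun h v

/-- Smoothness of the chart expression: if `κ : V → X` is `C^∞` at `q` and `κ q` lies in the
source of the chart `φ₀` at `x₀`, then `φ₀ ∘ κ` is `C^∞` at `q`
(`contMDiffAt_iff_target_of_mem_source`, `contMDiffAt_iff_contDiffAt`). [folklore] -/
theorem contDiffAt_extChartAt_comp_of_contMDiffAt {x₀ : X} {κ : V → X} {q : V}
    (hκ : ContMDiffAt 𝓘(ℝ, V) (𝓡 n) ∞ κ q)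
    (hq : κ q ∈ (chartAt (EuclideanSpace ℝ (Fin n)) x₀).source) :
    ContDiffAt ℝ ∞ (fun p : V => extChartAt (𝓡 n) x₀ (κ p)) q :=
  contMDiffAt_iff_contDiffAt.1 ((contMDiffAt_iff_target_of_mem_source hq).1 hκ).2

end ChartCalculus

/-- An injective continuous linear map between finite-dimensional real normed spaces of the same
dimension is invertible (`ContinuousLinearMap.IsInvertible`: it is the continuous linear
equivalence `LinearEquiv.ofInjectiveOfFinrankEq`). [folklore] -/
theorem isInvertible_of_injective_of_finrank_eq {E F : Type*} [NormedAddCommGroup E]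
    [NormedSpace ℝ E] [FiniteDimensional ℝ E] [NormedAddCommGroup F] [NormedSpace ℝ F]
    [FiniteDimensional ℝ F] (f : E →L[ℝ] F) (hf : Injective f)
    (h : Module.finrank ℝ E = Module.finrank ℝ F) : f.IsInvertible :=
  ⟨(LinearEquiv.ofInjectiveOfFinrankEq f.toLinearMap hf h).toContinuousLinearEquiv, by
    ext v; rfl⟩

end ChartLocalisation

/-! ### Existence of the coordinate expression -/

section Existence

variable {n : ℕ} {X : Type*} [TopologicalSpace X] [ChartedSpace (EuclideanSpace ℝ (Fin n)) X]
  [IsManifold (𝓡 n) ∞ X]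

open ChartLocalisation in
/-- **The coordinate expression of an almost complex structure through an immersion of an open
subset of the model space.** Let `J` be a field of tangent endomorphisms of the `C^∞` manifold
`X` (modelled on `ℝⁿ`) with `J x (J x v) = -v`, whose frame expression at every `x₀` is `C^∞` at
`x₀`; let `V` be a real normed space of dimension `n` and `κ : V → X` be `C^∞` on the open set `W`
with injective differential `mfderiv 𝓘(ℝ, V) (𝓡 n) κ q` at every `q ∈ W`. Then there is a field
`Jc : V → (V →L[ℝ] V)`, `C^∞` on `W`, with `Jc q (Jc q v) = -v` and
`dκ(q) (Jc q v) = J (κ q) (dκ(q) v)` for `q ∈ W`, `v : V` (namely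
`Jc q = dκ(q)⁻¹ ∘ J (κ q) ∘ dκ(q)`, the pull-back `κ^* J`; unique by `coordJ_unique`). Wendl 2018,
§2.2 (the local coordinate form of the Cauchy–Riemann equation); see the module docstring for the
proof. [folklore] -/
theorem exists_coordJ_of_immersion
    (J : ∀ x : X, TangentSpace (𝓡 n) x →L[ℝ] TangentSpace (𝓡 n) x)
    (hJ2 : ∀ (x : X) (v : TangentSpace (𝓡 n) x), J x (J x v) = -v)
    (hJ : ∀ x₀ : X, ContMDiffAt (𝓡 n)
      𝓘(ℝ, EuclideanSpace ℝ (Fin n) →L[ℝ] EuclideanSpace ℝ (Fin n)) ∞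
      (inTangentCoordinates (𝓡 n) (𝓡 n) (id : X → X) id (fun x => J x) x₀) x₀)
    {V : Type*} [NormedAddCommGroup V] [NormedSpace ℝ V] [FiniteDimensional ℝ V]
    (hV : Module.finrank ℝ V = n) (κ : V → X) (W : Set V) (hW : IsOpen W)
    (hκ : ContMDiffOn 𝓘(ℝ, V) (𝓡 n) ∞ κ W)
    (hκimm : ∀ q ∈ W, Injective (mfderiv 𝓘(ℝ, V) (𝓡 n) κ q)) :
    ∃ Jc : V → V →L[ℝ] V, ContDiffOn ℝ ∞ Jc W ∧ (∀ q ∈ W, ∀ v : V, Jc q (Jc q v) = -v) ∧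
      ∀ q ∈ W, ∀ v : V, mfderiv 𝓘(ℝ, V) (𝓡 n) κ q (Jc q v) =
        J (κ q) (mfderiv 𝓘(ℝ, V) (𝓡 n) κ q v) := by
  -- the differential of `κ` as an honest continuous linear map `V →L ℝⁿ`; it is invertible on `W`
  set L : V → V →L[ℝ] EuclideanSpace ℝ (Fin n) := fun q => mfderiv 𝓘(ℝ, V) (𝓡 n) κ q with hL
  have hLinv : ∀ q ∈ W, (L q).IsInvertible := fun q hq =>
    isInvertible_of_injective_of_finrank_eq _ (hκimm q hq)
      (by rw [hV, finrank_euclideanSpace_fin])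
  set Jt : ∀ q : V, EuclideanSpace ℝ (Fin n) →L[ℝ] EuclideanSpace ℝ (Fin n) :=
    fun q => J (κ q) with hJt
  -- the pointwise definition `Jc q = L⁻¹ ∘ J (κ q) ∘ L`
  set Jc : V → V →L[ℝ] V := fun q => (L q).inverse ∘L Jt q ∘L L q with hJc
  have hint : ∀ q ∈ W, ∀ v : V, L q (Jc q v) = Jt q (L q v) := fun q hq v => by
    simp only [hJc, ContinuousLinearMap.comp_apply]
    exact (hLinv q hq).self_apply_inverse _
  have hsq : ∀ q ∈ W, ∀ v : V, Jc q (Jc q v) = -v := fun q hq v => by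
    have h1 : Jc q (Jc q v) = (L q).inverse (Jt q (L q (Jc q v))) := by
      simp only [hJc, ContinuousLinearMap.comp_apply]
    rw [h1, hint q hq v]
    have h2 : Jt q (Jt q (L q v)) = -(L q v) := hJ2 (κ q) (L q v)
    rw [h2, map_neg, (hLinv q hq).inverse_apply_self]
  have huniq : ∀ q ∈ W, ∀ T : V →L[ℝ] V, (∀ v, L q (T v) = Jt q (L q v)) → T = Jc q :=
    fun q hq T hT => coordJ_unique J (hκimm q hq) hT (hint q hq)
  refine ⟨Jc, ?_, hsq, hint⟩
  -- smoothness: `Jc` agrees near each `q₀ ∈ W` with a smooth field built from a chart at `κ q₀`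
  intro q₀ hq₀
  obtain ⟨Jch, hJch, -, hJch3⟩ := exists_chartJ J hJ2 hJ (κ q₀)
  -- the open neighbourhood `W₀ = W ∩ κ⁻¹(chart domain)` of `q₀`
  set W₀ : Set V := W ∩ κ ⁻¹' (chartAt (EuclideanSpace ℝ (Fin n)) (κ q₀)).source with hW₀
  have hW₀o : IsOpen W₀ :=
    hκ.continuousOn.isOpen_inter_preimage hW (chartAt _ (κ q₀)).open_source
  have hq₀W₀ : q₀ ∈ W₀ := ⟨hq₀, mem_chart_source _ (κ q₀)⟩
  -- the chart expression `G = φ₀ ∘ κ` and its differential `D = A ∘ L`, invertible on `W₀`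
  set G : V → EuclideanSpace ℝ (Fin n) := fun p => extChartAt (𝓡 n) (κ q₀) (κ p) with hG
  have hGs : ContDiffOn ℝ ∞ G W₀ := fun q hq =>
    (contDiffAt_extChartAt_comp_of_contMDiffAt (hκ.contMDiffAt (hW.mem_nhds hq.1))
      hq.2).contDiffWithinAt
  have hDs : ContDiffOn ℝ ∞ (fderiv ℝ G) W₀ :=
    ((contDiffOn_infty_iff_fderiv_of_isOpen hW₀o).1 hGs).2
  have hD : ∀ q ∈ W₀, ∀ v, fderiv ℝ G q v =
      mfderiv (𝓡 n) 𝓘(ℝ, EuclideanSpace ℝ (Fin n)) (extChartAt (𝓡 n) (κ q₀)) (κ q) (L q v) :=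
    fun q hq v =>
    fderiv_extChartAt_comp_apply_of_contMDiffAt (hκ.contMDiffAt (hW.mem_nhds hq.1)) hq.2 v
  have hDinv : ∀ q ∈ W₀, (fderiv ℝ G q).IsInvertible := fun q hq =>
    isInvertible_of_injective_of_finrank_eq _ (by
      have h : ⇑(fderiv ℝ G q) =
          (mfderiv (𝓡 n) 𝓘(ℝ, EuclideanSpace ℝ (Fin n)) (extChartAt (𝓡 n) (κ q₀)) (κ q)) ∘
            (L q) := funext (hD q hq)
      rw [h]
      exact (mfderiv_extChartAt_injective hq.2).comp (hLinv q hq.1).injective)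
      (by rw [hV, finrank_euclideanSpace_fin])
  -- the local field `Jloc = D⁻¹ ∘ Jch ∘ D`, smooth on `W₀`
  set Jloc : V → V →L[ℝ] V :=
    fun q => (fderiv ℝ G q).inverse ∘L Jch (G q) ∘L fderiv ℝ G q with hJloc
  haveI : CompleteSpace V := FiniteDimensional.complete ℝ V
  have hJlocs : ContDiffOn ℝ ∞ Jloc W₀ := by
    have h1 : ContDiffOn ℝ ∞ (fun q => (fderiv ℝ G q).inverse) W₀ := fun q hq =>
      (hDinv q hq).contDiffAt_map_inverse.comp_contDiffWithinAt q (hDs q hq)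
    have h2 : ContDiffOn ℝ ∞ (fun q => Jch (G q)) W₀ :=
      hJch.comp hGs fun q hq => (extChartAt (𝓡 n) (κ q₀)).map_source
        (by rw [extChartAt_source]; exact hq.2)
    exact h1.clm_comp (h2.clm_comp hDs)
  -- `Jloc` is intertwined with `J` by `L` on `W₀`, hence agrees with `Jc` there
  have hJloc_eq : ∀ q ∈ W₀, Jloc q = Jc q := fun q hq => by
    apply huniq q hq.1
    intro v
    apply mfderiv_extChartAt_injective hq.2
    have h1 : fderiv ℝ G q (Jloc q v) = Jch (G q) (fderiv ℝ G q v) := by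
      simp only [hJloc, ContinuousLinearMap.comp_apply]
      exact (hDinv q hq).self_apply_inverse _
    rw [← hD q hq (Jloc q v), h1, hD q hq v]
    have h3 : Jch (G q) =
        inTangentCoordinates (𝓡 n) (𝓡 n) (id : X → X) id (fun x => J x) (κ q₀) (κ q) :=
      hJch3 (κ q) hq.2
    rw [h3, inTangentCoordinates_id_apply J hq.2,
      mfderivWithin_extChartAt_symm_apply_mfderiv_extChartAt hq.2]
    rfl
  exact ((hJlocs.contDiffAt (hW₀o.mem_nhds hq₀W₀)).congr_of_eventuallyEq
    (Filter.eventuallyEq_of_mem (hW₀o.mem_nhds hq₀W₀)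
      fun q hq => (hJloc_eq q hq).symm)).contDiffWithinAt

/-- **The coordinate expression of a bundled almost complex structure through an immersion of an
open subset of the model space**: `exists_coordJ_of_immersion` for
`JX : AlmostComplexStructure (𝓡 n) ∞ X` (its regularity hypothesis is
`AlmostComplexStructure.inTangentCoordinates_contMDiffAt`, its square is
`AlmostComplexStructure.map_map`). [folklore] -/
theorem exists_coordJ_of_immersion' (JX : AlmostComplexStructure (𝓡 n) ∞ X)
    {V : Type*} [NormedAddCommGroup V] [NormedSpace ℝ V] [FiniteDimensional ℝ V]
    (hV : Module.finrank ℝ V = n) (κ : V → X) (W : Set V) (hW : IsOpen W)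
    (hκ : ContMDiffOn 𝓘(ℝ, V) (𝓡 n) ∞ κ W)
    (hκimm : ∀ q ∈ W, Injective (mfderiv 𝓘(ℝ, V) (𝓡 n) κ q)) :
    ∃ Jc : V → V →L[ℝ] V, ContDiffOn ℝ ∞ Jc W ∧ (∀ q ∈ W, ∀ v : V, Jc q (Jc q v) = -v) ∧
      ∀ q ∈ W, ∀ v : V, mfderiv 𝓘(ℝ, V) (𝓡 n) κ q (Jc q v) =
        JX (κ q) (mfderiv 𝓘(ℝ, V) (𝓡 n) κ q v) :=
  exists_coordJ_of_immersion
    (fun x => (JX x : TangentSpace (𝓡 n) x →L[ℝ] TangentSpace (𝓡 n) x)) JX.map_map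
    JX.inTangentCoordinates_contMDiffAt hV κ W hW hκ hκimm

end Existence

end Literature.Geometry.Symplectic

end
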